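import Mathlib
import HarnessLib
import Summits.QuantumFields.YangMills.Theses.PencilRigidity
import Literature.MathematicalPhysics.QuantumFieldTheory.YangMillsOS
import Literature.MathematicalPhysics.QuantumLattice.LatticeGaugeDLRCovarianceSplit

/-!
# `CurvatureKernelBound` — lattice window bound: one-variable form ⇒ pair form (support for stmt-QuantumFields-11687)

Crux `stmt-QuantumFields-11687` (`PencilRigidity.CurvatureKernelBound`), line `sixteen-charts-analytic-kernel`, skeleton v9
glue (registered sub-goal `LatticeWindowPairOfOne`). The open core E‴₁ `LatticeKernelWindowBound` bounds the renormalised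
truncated plaquette covariance of Wilson's torus measure in ONE lattice variable,
`c_k² |Cov_k(Q_0, Q_z)| ≤ C (a_k‖z‖)^(η−10)` for `z ≠ 0` in the box with `R₀ ≤ ‖z‖`, `a_k‖z‖ ≤ θ` (frequently in `k`);
stub L3 `LatticeWindowTransfer` consumes the PAIR form `c_k² |Cov_k(Q_x, Q_y)| ≤ C (a_k‖x−y‖)^(η−10)` for sites `x, y` of the
box. Translation invariance of the torus Wilson state in lifted form (tree: `integral_comp_configShift_torusLift`) and the
composition law of `configShift` turn the one into the other: `Cov_k(Q_x, Q_y) = Cov_k(Q_0, Q_{y−x})`; the separation `y − x`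
lies in the box as soon as `a_k L_k ≥ θ` (`a_k L_k → ∞`), and `R₀ ↦ max R₀ 1` forces `y ≠ x`. [folklore]
-/

noncomputable section

open scoped BigOperators Topology
open MeasureTheory Filter Set
open Literature.MathematicalPhysics.QuantumLattice Literature.MathematicalPhysics.AQFT
open Literature.MathematicalPhysics.QuantumFieldTheory
open Literature.Probability.LatticeModels (Site box mem_box)

namespace Summit.QuantumFields.YangMills.Theorems.CurvatureKernel

namespace LatticeWindow

/-! ## Translations of the lifted observables -/

section Shift

variable {d : ℕ} {G : Type*} [MeasurableSpace G]

/-- Composition law of the lattice translations: `θ_a (θ_b U) = θ_{a+b} U`. [folklore] -/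
theorem configShift_configShift (a b : Site d) (U : LGConfig d G) :
    configShift a (configShift b U) = configShift (a + b) U := by
  funext e
  simp only [configShift_apply, sub_sub]

/-- `θ_0 = id`. [folklore] -/
theorem configShift_zero (U : LGConfig d G) : configShift (0 : Site d) U = U := by
  funext e
  simp [configShift_apply]

end Shift

/-- Coordinates of `siteToE` of a difference. [folklore] -/
theorem siteToE_sub {d : ℕ} (x y : Site d) : siteToE (x - y) = siteToE x - siteToE y := by
  ext i
  simp [siteToE_apply]

/-- `siteToE z = 0 ↔ z = 0`. [folklore] -/
theorem siteToE_eq_zero_iff {d : ℕ} (z : Site d) : siteToE z = 0 ↔ z = 0 := by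
  constructor
  · intro h
    funext i
    have := congrArg (fun v : EuclideanSpace ℝ (Fin d) => v i) h
    simpa [siteToE_apply] using this
  · rintro rfl
    ext i
    simp [siteToE_apply]

/-- A site whose Euclidean norm is at most `L` lies in `box d L`. [folklore] -/
theorem mem_box_of_norm_le {d : ℕ} {L : ℕ} {z : Site d} (hz : ‖siteToE z‖ ≤ L) : z ∈ box d L := by
  rw [mem_box]
  intro i
  have h1 : |(z i : ℝ)| ≤ L := by
    have h := PiLp.norm_apply_le (siteToE z) i
    rw [siteToE_apply, Real.norm_eq_abs] at h
    exact h.trans hz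
  rw [abs_le] at h1
  obtain ⟨h2, h3⟩ := h1
  exact ⟨by exact_mod_cast h2, by exact_mod_cast h3⟩

section Torus

variable {G : Type} [Group G] [TopologicalSpace G] [IsTopologicalGroup G] [CompactSpace G]
  [MeasurableSpace G] [BorelSpace G]

/-- **Covariances of shifted lifted observables depend only on the separation**: for the torus Wilson state,
`Cov(F ∘ θ_{−x}, F ∘ θ_{−y}) = Cov(F, F ∘ θ_{x−y})` (translation invariance in lifted form, `θ_x` applied to the
product and to each factor). [folklore] -/
theorem cov_shift_eq {N : ℕ} (ρ : G →* Matrix (Fin N) (Fin N) ℂ) (β : ℝ) (S : ℕ) [NeZero S]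
    (F : LGConfig 4 G → ℝ) (x y : Site 4) :
    (∫ U, F (configShift (-x) (torusLift S U)) * F (configShift (-y) (torusLift S U))
        ∂(wilsonMeasure ρ β : Measure (GaugeConfig 4 S G))) -
      (∫ U, F (configShift (-x) (torusLift S U)) ∂(wilsonMeasure ρ β : Measure (GaugeConfig 4 S G))) *
      (∫ U, F (configShift (-y) (torusLift S U)) ∂(wilsonMeasure ρ β : Measure (GaugeConfig 4 S G))) =
    (∫ U, F (torusLift S U) * F (configShift (-(y - x)) (torusLift S U))
        ∂(wilsonMeasure ρ β : Measure (GaugeConfig 4 S G))) -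
      (∫ U, F (torusLift S U) ∂(wilsonMeasure ρ β : Measure (GaugeConfig 4 S G))) *
      (∫ U, F (configShift (-(y - x)) (torusLift S U)) ∂(wilsonMeasure ρ β : Measure (GaugeConfig 4 S G))) := by
  have hxy : -(y - x) = -y + x := by abel
  have h2 := integral_comp_configShift_torusLift (d := 4) (S := S) ρ β
    (fun V => F (configShift (-x) V) * F (configShift (-y) V)) x
  have h1 := integral_comp_configShift_torusLift (d := 4) (S := S) ρ β (fun V => F (configShift (-x) V)) x
  have h1' := integral_comp_configShift_torusLift (d := 4) (S := S) ρ β (fun V => F (configShift (-y) V)) x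
  simp only [configShift_configShift, neg_add_cancel, configShift_zero] at h2 h1 h1'
  rw [← h2, ← h1, ← h1', hxy]

end Torus

end LatticeWindow

open LatticeWindow in
/-- **`LatticeWindowPairOfOne`** (registered sub-goal of stmt-QuantumFields-11687; skeleton v9 glue of line
`sixteen-charts-analytic-kernel`). The one-variable lattice window bound (`c_k² |Cov_k(Q_0,Q_z)| ≤ C (a_k‖z‖)^(η−10)` for
`z ≠ 0` in the box, `R₀ ≤ ‖z‖`, `a_k‖z‖ ≤ θ`, frequently in `k`) implies the pair form consumed by stub L3
(`c_k² |Cov_k(Q_x,Q_y)| ≤ C (a_k‖x−y‖)^(η−10)` for `x, y` in the box, `max R₀ 1 ≤ ‖x−y‖`, `a_k‖x−y‖ ≤ θ`). [folklore] -/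
theorem LatticeWindowPairOfOne : open Literature.MathematicalPhysics.QuantumLattice Literature.MathematicalPhysics.AQFT Literature.MathematicalPhysics.QuantumFieldTheory in ∀ (G : Type) [Group G] [TopologicalSpace G] [IsTopologicalGroup G] [CompactSpace G] [MeasurableSpace G] [BorelSpace G] (r : LatticeRep G) (sch : SpeciesScheme (YMSpecies G)), (∃ (C η θ R₀ : ℝ), 0 < η ∧ 0 < θ ∧ ∃ᶠ k in Filter.atTop, ∀ z : Literature.Probability.LatticeModels.Site 4, z ∈ Literature.Probability.LatticeModels.box 4 (sch.L k) → z ≠ 0 → R₀ ≤ ‖siteToE z‖ → sch.a k * ‖siteToE z‖ ≤ θ → (sch.c r.curvature k) ^ 2 * |(∫ U, r.curvature.F (torusLift (sch.side k) U) * r.curvature.F (configShift (-z) (torusLift (sch.side k) U)) ∂(wilsonMeasure r.ρ (sch.β k) : MeasureTheory.Measure (GaugeConfig 4 (sch.side k) G))) - (∫ U, r.curvature.F (torusLift (sch.side k) U) ∂(wilsonMeasure r.ρ (sch.β k) : MeasureTheory.Measure (GaugeConfig 4 (sch.side k) G))) * (∫ U, r.curvature.F (configShift (-z) (torusLift (sch.side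 k) U)) ∂(wilsonMeasure r.ρ (sch.β k) : MeasureTheory.Measure (GaugeConfig 4 (sch.side k) G)))| ≤ C * (sch.a k * ‖siteToE z‖) ^ (η - 10)) → (∃ (C η θ R₀ : ℝ), 0 < η ∧ 0 < θ ∧ ∃ᶠ k in Filter.atTop, ∀ x y : Literature.Probability.LatticeModels.Site 4, x ∈ Literature.Probability.LatticeModels.box 4 (sch.L k) → y ∈ Literature.Probability.LatticeModels.box 4 (sch.L k) → R₀ ≤ ‖siteToE x - siteToE y‖ → sch.a k * ‖siteToE x - siteToE y‖ ≤ θ → (sch.c r.curvature k) ^ 2 * |(∫ U, r.curvature.F (configShift (-x) (torusLift (sch.side k) U)) * r.curvature.F (configShift (-y) (torusLift (sch.side k) U)) ∂(wilsonMeasure r.ρ (sch.β k) : MeasureTheory.Measure (GaugeConfig 4 (sch.side k) G))) - (∫ U, r.curvature.F (configShift (-x) (torusLift (sch.side k) U)) ∂(wilsonMeasure r.ρ (sch.β k) : MeasureTheory.Measure (GaugeConfig 4 (sch.side k) G))) * (∫ U, r.curvature.F (configShift (-y) (torusLift (sch.side k) U)) ∂(wilsonMeasure r.ρ (sch.β k)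 : MeasureTheory.Measure (GaugeConfig 4 (sch.side k) G)))| ≤ C * (sch.a k * ‖siteToE x - siteToE y‖) ^ (η - 10)) := by
  intro G _ _ _ _ _ _ r sch hone
  obtain ⟨C, η, θ, R₀, hη, hθ, hfreq⟩ := hone
  refine ⟨C, η, θ, max R₀ 1, hη, hθ, ?_⟩
  have hev : ∀ᶠ k in atTop, θ ≤ sch.a k * sch.L k := Filter.tendsto_atTop.1 sch.tendsto_L θ
  refine (hfreq.and_eventually hev).mono ?_
  rintro k ⟨hk, hkL⟩ x y _ _ hR hθ'
  have hak : 0 < sch.a k := sch.a_pos k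
  -- the separation
  have hnorm : ‖siteToE x - siteToE y‖ = ‖siteToE (y - x)‖ := by
    rw [siteToE_sub, norm_sub_rev]
  rw [hnorm] at hR hθ' ⊢
  have hR₀ : R₀ ≤ ‖siteToE (y - x)‖ := (le_max_left _ _).trans hR
  have h1 : (1 : ℝ) ≤ ‖siteToE (y - x)‖ := (le_max_right _ _).trans hR
  have hz0 : y - x ≠ 0 := by
    intro h0
    rw [(siteToE_eq_zero_iff _).2 h0, norm_zero] at h1
    exact absurd h1 (by norm_num)
  have hzbox : y - x ∈ box 4 (sch.L k) := by
    refine mem_box_of_norm_le ?_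
    by_contra hlt
    push Not at hlt
    have : sch.a k * sch.L k < sch.a k * ‖siteToE (y - x)‖ := mul_lt_mul_of_pos_left hlt hak
    linarith
  have hb := hk (y - x) hzbox hz0 hR₀ hθ'
  rw [cov_shift_eq]
  exact hb

end Summit.QuantumFields.YangMills.Theorems.CurvatureKernel

end
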